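import Literature.Barriers.Parity.SiegelZeroDichotomyPairHLPsiFourier
import Mathlib.NumberTheory.Harmonic.ZetaAsymp
import Mathlib.NumberTheory.LSeries.Dirichlet
import Mathlib.NumberTheory.EulerProduct.DirichletLSeries
import Mathlib.Analysis.SumIntegralComparisons
import Mathlib.Analysis.SpecialFunctions.Integrals.Basic
import Mathlib.Analysis.SpecialFunctions.ImproperIntegrals
import HarnessLib

/-!
# Tao–Teräväinen 2022, §8 (`k = 2`): the Möbius slot `∫ ĝ_c(τ) ∏_p (1 - p^{-s(τ)}) dτ ≈ 1` via `ζ`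

Topic `Literature/Barriers/Parity`, sub-namespace `TaoTeravainen`; part of step (v) of the proof DAG
of `Literature.Barriers.Parity.TaoTeravainen2021_prop72_81_pair` (T. Tao, J. Teräväinen, *The
Hardy–Littlewood–Chowla conjecture in the presence of a Siegel zero*, J. London Math. Soc. (2) 106
(2022), arXiv:2109.06291), end of §8: "From the Euler product formula (2.7) as well as (8.21), we
conclude that `∏_p E_{p,t} = 𝔖 log^{-k} x ∏_j (1+t_{0,j}) + O(log^{-k} x / log^{1/(7k)} η)`. Inserting
this … and using (8.14) to remove the restriction (8.21), we can thus write the left-hand side of (8.8)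
as `≈ 𝔖 ∫ ∏_j (1+t_{0,j}) F_j(t_{0,j}) f(t_{1,j}) f(t_{2,j}) dt`. Using (8.15), (8.16) we obtain (8.8)
as desired." Here (2.7) is `∏_p (1 - 1/p^s) = 1/ζ(s)` for `Re s > 1`, with "`ζ(s) = 1/(s-1) + O(1)`",
and (8.16) is `∫ F_j(t)(1+it) dt = 1`.

In our normalisation (one `d`-slot with the transform `ĝ_c` of `SiegelZeroDichotomyPairHLPsiFourier.lean`,
`s(τ) = 1 + 1/X - 2πiτ`), everything here is PROVED:

* `zetaSlotS X τ = 1 + 1/X - 2πiτ`, `eulerTrunc N s = ∏_{p < N} (1 - p^{-s})`;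
* the model identity `integral_psiFourier_eulerTrunc_eq_sum` —
  `∫ ĝ_c(τ) ∏_{p<N}(1 - p^{-s(τ)}) dτ = ∑_{t ⊆ primes<N} (-1)^{|t|} Ψ(e^{c - log d_t})/d_t`, `d_t = ∏_{p∈t} p`
  (finite expansion and the Fourier representation of `Ψ`), and its stability in `N` beyond the
  support of `Ψ` (`sum_powerset_eq_of_support`);
* `ζ` inputs from Mathlib: `∏_{p<N}(1-p^{-s}) → ζ(s)^{-1}` (`riemannZeta_eulerProduct`), the crude bounds
  `‖∏_{p<N}(1-p^{-s})‖ ≤ e^{1/(Re s - 1)}`, `‖ζ(s)^{-1}‖ ≤ 1 + 1/(Re s - 1)` (`L(μ, s) = ζ(s)^{-1}`), and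
  near `s = 1`: `‖ζ(1+σ)^{-1} - σ‖ ≤ 2C₀‖σ‖²` for `‖σ‖ ≤ 1/(2C₀)` (`ζ(s) = (s-1)^{-1} + ζ₀(s)`, `ζ₀` entire);
* **`abs_integral_psiFourier_eulerTrunc_sub_one_le`** — for `N` beyond the support,
  `|∫ ĝ_c(τ) ∏_{p<N}(1 - p^{-s(τ)}) dτ - 1| ≤ 8C₀ τ₀ S (1/X + 2πτ₀)² + 14 (X+2) D_n (1+U₀τ₀)^{2-n}/((n-2)U₀)`
  for every `0 < τ₀` with `1/X + 2πτ₀ ≤ 1/(2C₀)` and `n ≥ 3`, where `S = 6eU₀(X+2U₀)M₀` bounds `‖ĝ_c‖`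
  and `D_n` is the decay constant of `psiFourier_decay` (dominated convergence in `N`, the identity
  `∫ ĝ_c(τ)(1/X - 2πiτ) dτ = 1`, and the split at `|τ| = τ₀`).
  [cite: TaoTeravainen2021, §8 (8.25) with (2.7), (8.15)–(8.16)]
-/

noncomputable section

open Real MeasureTheory Set Filter Complex Finset
open scoped Topology FourierTransform

namespace Literature.Barriers.Parity

namespace TaoTeravainen

/-! ### `ζ` near `1`, and the crude bound for `ζ⁻¹` -/

/-- `ζ₀` is bounded on the closed unit disc around `1`: `∃ C₀ ≥ 1, ‖ζ₀(1+σ)‖ ≤ C₀` for `‖σ‖ ≤ 1`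
("`ζ(s) = 1/(s-1) + O(1)`"). [cite: TaoTeravainen2021, §2 (after (2.7))] -/
theorem exists_bound_riemannZeta₀ : ∃ C₀ : ℝ, 1 ≤ C₀ ∧ ∀ σ : ℂ, ‖σ‖ ≤ 1 → ‖riemannZeta₀ (1 + σ)‖ ≤ C₀ := by
  have hcont : Continuous fun σ : ℂ => riemannZeta₀ (1 + σ) :=
    differentiable_riemannZeta₀.continuous.comp (continuous_const.add continuous_id)
  obtain ⟨C, hC⟩ := (isCompact_closedBall (0 : ℂ) 1).exists_bound_of_continuousOn hcont.continuousOn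
  refine ⟨max C 1, le_max_right _ _, fun σ hσ => (hC σ ?_).trans (le_max_left _ _)⟩
  rwa [Metric.mem_closedBall, dist_zero_right]

/-- **`ζ(1+σ)⁻¹ = σ + O(|σ|²)`**: if `‖ζ₀(1+σ)‖ ≤ C₀` on `‖σ‖ ≤ 1` then for `0 < ‖σ‖ ≤ 1/(2C₀)` (`C₀ ≥ 1`),
`‖ζ(1+σ)⁻¹ - σ‖ ≤ 2 C₀ ‖σ‖²`. [cite: TaoTeravainen2021, §2 ("`ζ(s) = 1/(s-1) + O(1)`") and §8 (8.25)] -/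
theorem norm_inv_riemannZeta_sub_le {C₀ : ℝ} (hC₀ : 1 ≤ C₀) (hζ₀ : ∀ σ : ℂ, ‖σ‖ ≤ 1 → ‖riemannZeta₀ (1 + σ)‖ ≤ C₀)
    {σ : ℂ} (hσ0 : σ ≠ 0) (hσ : ‖σ‖ ≤ 1 / (2 * C₀)) :
    ‖(riemannZeta (1 + σ))⁻¹ - σ‖ ≤ 2 * C₀ * ‖σ‖ ^ 2 := by
  have hC₀0 : 0 < C₀ := by linarith
  have hσ1 : ‖σ‖ ≤ 1 := hσ.trans (by rw [div_le_one (by positivity)]; linarith)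
  set r := riemannZeta₀ (1 + σ) with hr
  have hrC : ‖r‖ ≤ C₀ := hζ₀ σ hσ1
  have hζ : riemannZeta (1 + σ) = σ⁻¹ + r := by
    rw [riemannZeta_eq_inv_sub_add (by simpa using hσ0), add_sub_cancel_left]
  -- `1 + σ r ≠ 0`, indeed `‖σ r‖ ≤ 1/2`
  have hσr : ‖σ * r‖ ≤ 1 / 2 := by
    rw [norm_mul]
    calc ‖σ‖ * ‖r‖ ≤ (1 / (2 * C₀)) * C₀ := mul_le_mul hσ hrC (norm_nonneg _) (by positivity)
      _ = 1 / 2 := by field_simp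
  have hne : 1 + σ * r ≠ 0 := by
    intro h
    have : ‖σ * r‖ = 1 := by rw [show σ * r = -1 from by linear_combination h]; simp
    linarith
  have hζ' : riemannZeta (1 + σ) = (1 + σ * r) / σ := by rw [hζ]; field_simp
  have hkey : (riemannZeta (1 + σ))⁻¹ - σ = -(σ ^ 2 * r) / (1 + σ * r) := by
    rw [hζ', inv_div]; field_simp; ring
  rw [hkey, norm_div, norm_neg, norm_mul, norm_pow]
  have hden : 1 / 2 ≤ ‖1 + σ * r‖ := by
    have := norm_sub_norm_le (1 : ℂ) (-(σ * r))
    rw [sub_neg_eq_add, norm_neg, norm_one] at this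
    linarith
  rw [div_le_iff₀ (by linarith)]
  calc ‖σ‖ ^ 2 * ‖r‖ ≤ ‖σ‖ ^ 2 * C₀ := mul_le_mul_of_nonneg_left hrC (by positivity)
    _ = 2 * C₀ * ‖σ‖ ^ 2 * (1 / 2) := by ring
    _ ≤ 2 * C₀ * ‖σ‖ ^ 2 * ‖1 + σ * r‖ := mul_le_mul_of_nonneg_left hden (by positivity)

/-- `∑_{n<N} (n^a)⁻¹ ≤ 1 + 1/(a-1)` for real `a > 1` (the term `n = 0` is `0`). [folklore] -/
theorem sum_range_rpow_inv_le {a : ℝ} (ha : 1 < a) (N : ℕ) :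
    ∑ n ∈ Finset.range N, ((n : ℝ) ^ a)⁻¹ ≤ 1 + 1 / (a - 1) := by
  have ha0 : 0 < a := by linarith
  have ha' : 0 < a - 1 := by linarith
  have hRHS : (1 : ℝ) ≤ 1 + 1 / (a - 1) := le_add_of_nonneg_right (by positivity)
  rcases Nat.lt_or_ge N 3 with hN | hN
  · interval_cases N
    · rw [Finset.sum_range_zero]; linarith
    · rw [Finset.sum_range_one, Nat.cast_zero, Real.zero_rpow ha0.ne', inv_zero]; linarith
    · rw [Finset.sum_range_succ, Finset.sum_range_one, Nat.cast_zero, Real.zero_rpow ha0.ne', inv_zero, zero_add,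
        Nat.cast_one, Real.one_rpow, inv_one]
      exact hRHS
  -- `range N = {0, 1} ∪ image (·+1) (Ico 1 (N-1))`
  have hsplit : ∑ n ∈ Finset.range N, ((n : ℝ) ^ a)⁻¹ = 1 + ∑ i ∈ Finset.Ico 1 (N - 1), (((i + 1 : ℕ) : ℝ) ^ a)⁻¹ := by
    have hr : Finset.range N = insert 0 (insert 1 ((Finset.Ico 1 (N - 1)).image (· + 1))) := by
      ext n
      simp only [Finset.mem_range, Finset.mem_insert, Finset.mem_image, Finset.mem_Ico]
      constructor
      · intro h
        by_cases h0 : n = 0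
        · exact Or.inl h0
        by_cases h1 : n = 1
        · exact Or.inr (Or.inl h1)
        exact Or.inr (Or.inr ⟨n - 1, by omega, by omega⟩)
      · rintro (h | h | ⟨m, hm, rfl⟩) <;> omega
    rw [hr, Finset.sum_insert, Finset.sum_insert, Finset.sum_image]
    · simp [Real.zero_rpow ha0.ne']
    · intro x _ y _ h; simpa using h
    · simp only [Finset.mem_image, Finset.mem_Ico, not_exists, not_and]; intro m hm; omega
    · simp only [Finset.mem_insert, Finset.mem_image, Finset.mem_Ico, not_or, not_exists, not_and]
      exact ⟨by norm_num, fun m hm => by omega⟩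
  rw [hsplit]
  gcongr
  have hanti : AntitoneOn (fun x : ℝ => (x ^ a)⁻¹) (Set.Icc ((1 : ℕ) : ℝ) ((N - 1 : ℕ) : ℝ)) := by
    intro x hx y hy hxy
    have hx1 : (1 : ℝ) ≤ x := by simpa using hx.1
    have hy1 : (1 : ℝ) ≤ y := by linarith
    exact inv_anti₀ (by positivity) (Real.rpow_le_rpow (by linarith) hxy ha0.le)
  have hcmp := AntitoneOn.sum_le_integral_Ico (f := fun x : ℝ => (x ^ a)⁻¹) (a := 1) (b := N - 1) (by omega) hanti
  refine hcmp.trans ?_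
  have hN1 : (1 : ℝ) ≤ ((N - 1 : ℕ) : ℝ) := by exact_mod_cast (show 1 ≤ N - 1 by omega)
  have hint : ∫ x in ((1 : ℕ) : ℝ)..((N - 1 : ℕ) : ℝ), (x ^ a)⁻¹ = (((N - 1 : ℕ) : ℝ) ^ (-a + 1) - 1) / (-a + 1) := by
    have h1 : ∫ x in ((1 : ℕ) : ℝ)..((N - 1 : ℕ) : ℝ), (x ^ a)⁻¹ = ∫ x in ((1 : ℕ) : ℝ)..((N - 1 : ℕ) : ℝ), x ^ (-a) := by
      refine intervalIntegral.integral_congr fun x hx => ?_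
      rw [Set.uIcc_of_le (by simpa using hN1), Set.mem_Icc] at hx
      have hx1 : (1 : ℝ) ≤ x := by exact_mod_cast hx.1
      rw [Real.rpow_neg (by linarith)]
    rw [h1, integral_rpow (Or.inr ⟨by linarith, ?_⟩)]
    · simp
    · rw [Set.mem_uIcc]
      push Not
      simp only [Nat.cast_one]
      constructor <;> intro h <;> linarith
  rw [hint]
  have h1 : 0 ≤ ((N - 1 : ℕ) : ℝ) ^ (-a + 1) := by positivity
  have key : (((N - 1 : ℕ) : ℝ) ^ (-a + 1) - 1) / (-a + 1) = (1 - ((N - 1 : ℕ) : ℝ) ^ (-a + 1)) / (a - 1) := by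
    rw [show -a + 1 = -(a - 1) by ring, div_neg, ← neg_div, neg_sub]
  rw [key]
  exact div_le_div_of_nonneg_right (by linarith) ha'.le

/-- `∑' n, (n^a)⁻¹ ≤ 1 + 1/(a - 1)` for `a > 1`. [folklore] -/
theorem tsum_rpow_inv_le {a : ℝ} (ha : 1 < a) : ∑' n : ℕ, ((n : ℝ) ^ a)⁻¹ ≤ 1 + 1 / (a - 1) :=
  Real.tsum_le_of_sum_range_le (fun n => by positivity) fun N => sum_range_rpow_inv_le ha N

/-- **The crude bound for `ζ⁻¹`**: `‖ζ(s)⁻¹‖ ≤ 1 + 1/(Re s - 1)` for `Re s > 1` (`ζ(s)⁻¹ = ∑ μ(n) n^{-s}`).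
[cite: TaoTeravainen2021, §2 (2.7)] -/
theorem norm_inv_riemannZeta_le {s : ℂ} (hs : 1 < s.re) : ‖(riemannZeta s)⁻¹‖ ≤ 1 + 1 / (s.re - 1) := by
  have h := ArithmeticFunction.LSeries_zeta_mul_Lseries_moebius hs
  rw [ArithmeticFunction.LSeries_zeta_eq_riemannZeta hs] at h
  rw [← eq_inv_of_mul_eq_one_right h]
  have hsum : LSeriesSummable (fun n => (ArithmeticFunction.moebius n : ℂ)) s :=
    ArithmeticFunction.LSeriesSummable_moebius_iff.mpr hs
  unfold LSeries
  refine (norm_tsum_le_tsum_norm hsum.norm).trans ?_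
  have hterm : ∀ n, ‖LSeries.term (fun n => (ArithmeticFunction.moebius n : ℂ)) s n‖ ≤ ((n : ℝ) ^ s.re)⁻¹ := by
    intro n
    rw [LSeries.norm_term_eq]
    split_ifs with hn
    · positivity
    · rw [div_eq_mul_inv]
      refine mul_le_of_le_one_left (by positivity) ?_
      exact_mod_cast ArithmeticFunction.abs_moebius_le_one
  have hg : Summable fun n : ℕ => ((n : ℝ) ^ s.re)⁻¹ := Real.summable_nat_rpow_inv.mpr hs
  exact (hsum.norm.tsum_le_tsum hterm hg).trans (tsum_rpow_inv_le hs)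

/-! ### Truncated Euler products -/

/-- The slot variable `s(τ) := 1 + 1/X - 2πiτ` (`Re s = 1 + 1/X`). [cite: TaoTeravainen2021, §8
(the exponent `1 + (1+it)/log x`)] -/
def zetaSlotS (X τ : ℝ) : ℂ := ((1 + X⁻¹ : ℝ) : ℂ) - 2 * π * τ * I

/-- `Re s(τ) = 1 + 1/X`. [folklore] -/
theorem re_zetaSlotS (X τ : ℝ) : (zetaSlotS X τ).re = 1 + X⁻¹ := by
  simp [zetaSlotS]

/-- `s(τ)` is continuous in `τ`. [folklore] -/
theorem continuous_zetaSlotS (X : ℝ) : Continuous (zetaSlotS X) := by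
  unfold zetaSlotS; fun_prop

/-- The truncated Euler product `∏_{p < N} (1 - p^{-s})`. [cite: TaoTeravainen2021, §2 (2.7)] -/
def eulerTrunc (N : ℕ) (s : ℂ) : ℂ := ∏ p ∈ Nat.primesBelow N, (1 - (p : ℂ) ^ (-s))

/-- **(2.7)**: `∏_{p<N}(1 - p^{-s}) → ζ(s)⁻¹` for `Re s > 1`. [cite: TaoTeravainen2021, §2 (2.7)] -/
theorem tendsto_eulerTrunc {s : ℂ} (hs : 1 < s.re) :
    Tendsto (fun N => eulerTrunc N s) atTop (𝓝 (riemannZeta s)⁻¹) := by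
  have h := (riemannZeta_eulerProduct hs).inv₀ (riemannZeta_ne_zero_of_one_lt_re hs)
  refine h.congr fun N => ?_
  unfold eulerTrunc
  rw [← Finset.prod_inv_distrib]
  simp

/-- `‖(p : ℂ)^{-s}‖ = p^{-Re s}` for `p ≥ 1`. [folklore] -/
theorem norm_natCast_cpow_neg {p : ℕ} (hp : 0 < p) (s : ℂ) : ‖(p : ℂ) ^ (-s)‖ = ((p : ℝ) ^ s.re)⁻¹ := by
  rw [Complex.norm_natCast_cpow_of_pos hp, Complex.neg_re, Real.rpow_neg (Nat.cast_nonneg p)]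

/-- **Uniform bound for the truncated products**: `‖∏_{p<N}(1 - p^{-s})‖ ≤ exp(1 + 1/(Re s - 1))`.
[folklore] -/
theorem norm_eulerTrunc_le {s : ℂ} (hs : 1 < s.re) (N : ℕ) :
    ‖eulerTrunc N s‖ ≤ Real.exp (1 + 1 / (s.re - 1)) := by
  unfold eulerTrunc
  rw [norm_prod]
  have hterm : ∀ p ∈ Nat.primesBelow N, ‖1 - (p : ℂ) ^ (-s)‖ ≤ Real.exp (((p : ℝ) ^ s.re)⁻¹) := by
    intro p hp
    have hp0 : 0 < p := (Nat.prime_of_mem_primesBelow hp).pos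
    calc ‖1 - (p : ℂ) ^ (-s)‖ ≤ ‖(1 : ℂ)‖ + ‖(p : ℂ) ^ (-s)‖ := norm_sub_le _ _
      _ = 1 + ((p : ℝ) ^ s.re)⁻¹ := by rw [norm_one, norm_natCast_cpow_neg hp0]
      _ ≤ Real.exp (((p : ℝ) ^ s.re)⁻¹) := by rw [add_comm]; exact Real.add_one_le_exp _
  calc ∏ p ∈ Nat.primesBelow N, ‖1 - (p : ℂ) ^ (-s)‖ ≤ ∏ p ∈ Nat.primesBelow N, Real.exp (((p : ℝ) ^ s.re)⁻¹) :=
        Finset.prod_le_prod (fun p _ => norm_nonneg _) hterm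
    _ = Real.exp (∑ p ∈ Nat.primesBelow N, ((p : ℝ) ^ s.re)⁻¹) := by rw [Real.exp_sum]
    _ ≤ Real.exp (∑ n ∈ Finset.range N, ((n : ℝ) ^ s.re)⁻¹) := by
        refine Real.exp_le_exp.mpr (Finset.sum_le_sum_of_subset_of_nonneg (fun p hp => ?_) fun n _ _ => by positivity)
        exact Finset.mem_range.mpr (Nat.lt_of_mem_primesBelow hp)
    _ ≤ Real.exp (1 + 1 / (s.re - 1)) := Real.exp_le_exp.mpr (sum_range_rpow_inv_le hs N)

/-- `((∏_{p∈t} p : ℕ) : ℂ)^s = ∏_{p∈t} (p : ℂ)^s`. [folklore] -/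
theorem natCast_prod_cpow {ι : Type*} (t : Finset ι) (g : ι → ℕ) (s : ℂ) :
    (((∏ i ∈ t, g i : ℕ) : ℂ)) ^ s = ∏ i ∈ t, ((g i : ℕ) : ℂ) ^ s := by
  classical
  induction t using Finset.induction_on with
  | empty => simp
  | insert a t ha ih => rw [Finset.prod_insert ha, Finset.prod_insert ha, Nat.cast_mul, natCast_mul_natCast_cpow, ih]

/-- **Expansion of the truncated product**: `∏_{p∈S}(1 - p^{-s}) = ∑_{t ⊆ S} (-1)^{|t|} (∏_{p∈t} p)^{-s}`.
[cite: TaoTeravainen2021, §2 (2.7) ("the Euler product formula")] -/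
theorem eulerTrunc_eq_sum_powerset (N : ℕ) (s : ℂ) :
    eulerTrunc N s = ∑ t ∈ (Nat.primesBelow N).powerset, (-1) ^ #t * (((∏ p ∈ t, p : ℕ) : ℂ)) ^ (-s) := by
  unfold eulerTrunc
  have h1 : ∏ p ∈ Nat.primesBelow N, (1 - (p : ℂ) ^ (-s)) = ∏ p ∈ Nat.primesBelow N, (-(p : ℂ) ^ (-s) + 1) :=
    Finset.prod_congr rfl fun p _ => by ring
  rw [h1, Finset.prod_add]
  refine Finset.sum_congr rfl fun t _ => ?_
  rw [Finset.prod_const_one, mul_one, Finset.prod_neg, natCast_prod_cpow]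

/-- For `d ≥ 1`: `d^{-s(τ)} = d⁻¹ e^{-log d/X} e^{2πiτ log d}`. [folklore] -/
theorem natCast_cpow_neg_zetaSlotS {d : ℕ} (hd : 0 < d) (X τ : ℝ) :
    ((d : ℂ)) ^ (-zetaSlotS X τ) =
      ((d : ℝ)⁻¹ : ℝ) * (Complex.exp (-(↑(X⁻¹ * Real.log d))) * Complex.exp (↑(2 * π * (τ * Real.log d)) * I)) := by
  have hd0 : (d : ℂ) ≠ 0 := by exact_mod_cast hd.ne'
  rw [Complex.cpow_def_of_ne_zero hd0, ← Complex.natCast_log, ← mul_assoc]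
  have hexp : (((d : ℝ)⁻¹ : ℝ) : ℂ) = Complex.exp (-(Real.log d : ℂ)) := by
    rw [Complex.exp_neg, ← Complex.ofReal_exp, Real.exp_log (by exact_mod_cast hd)]
    push_cast; rfl
  rw [hexp, ← Complex.exp_add, ← Complex.exp_add]
  congr 1
  unfold zetaSlotS
  push_cast
  ring

/-- **The model identity**: `∫ ĝ_c(τ) ∏_{p<N}(1 - p^{-s(τ)}) dτ = ∑_{t ⊆ primes<N} (-1)^{|t|} Ψ(e^{c - log d_t})/d_t`
(`d_t = ∏_{p∈t} p`; `U₀ ≥ 1`, `2U₀ + 2 ≤ X`, `3U₀ ≤ X`, `c ≤ X + 1`).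
[cite: TaoTeravainen2021, §8 ((8.13) read backwards: "`Φ((y+h_j)/d) = log x ∫ d^{-(1+it)/log x} F_j(t) dt`")] -/
theorem integral_psiFourier_eulerTrunc_eq_sum {φ ψ : ℝ → ℝ} (hφ : IsBump φ) (hψ : IsSmoothCutoff ψ)
    {X U₀ : ℝ} (hU₀ : 1 ≤ U₀) (hX : 2 * U₀ + 2 ≤ X) (hX3 : 3 * U₀ ≤ X) {c : ℝ} (hc : c ≤ X + 1) (N : ℕ) :
    ∫ τ : ℝ, psiFourier φ ψ X U₀ c τ * eulerTrunc N (zetaSlotS X τ) =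
      ∑ t ∈ (Nat.primesBelow N).powerset,
        (-1) ^ #t * (((∏ p ∈ t, p : ℕ) : ℝ)⁻¹ : ℝ) *
          ((psiSharp φ ψ X U₀ (Real.exp (c - Real.log ((∏ p ∈ t, p : ℕ) : ℝ))) : ℝ) : ℂ) := by
  have hFint := (integrable_psiFourier hφ hψ hU₀ hX hc).1
  -- termwise integrability: `|ĝ| · 1`
  have hdpos : ∀ t ∈ (Nat.primesBelow N).powerset, 0 < ∏ p ∈ t, p := fun t ht =>
    Finset.prod_pos fun p hp => (Nat.prime_of_mem_primesBelow (Finset.mem_powerset.mp ht hp)).pos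
  have hint : ∀ t ∈ (Nat.primesBelow N).powerset, Integrable fun τ : ℝ =>
      psiFourier φ ψ X U₀ c τ * ((-1) ^ #t * (((∏ p ∈ t, p : ℕ) : ℂ)) ^ (-zetaSlotS X τ)) := by
    intro t ht
    have hcont : Continuous fun τ : ℝ => (-1 : ℂ) ^ #t * (((∏ p ∈ t, p : ℕ) : ℂ)) ^ (-zetaSlotS X τ) := by
      refine continuous_const.mul ?_
      exact (continuous_const.cpow (continuous_zetaSlotS X).neg fun τ => Or.inl (by
        exact_mod_cast hdpos t ht)) 
    refine hFint.mul_bdd (c := 1) hcont.aestronglyMeasurable (ae_of_all _ fun τ => ?_)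
    rw [norm_mul, norm_pow, norm_neg, norm_one, one_pow, one_mul, norm_natCast_cpow_neg (hdpos t ht), re_zetaSlotS]
    have h1 : (1 : ℝ) ≤ ((∏ p ∈ t, p : ℕ) : ℝ) ^ (1 + X⁻¹) := by
      refine Real.one_le_rpow (by exact_mod_cast hdpos t ht) ?_
      have : 0 < X := by linarith
      positivity
    exact inv_le_one_of_one_le₀ h1
  simp_rw [eulerTrunc_eq_sum_powerset, Finset.mul_sum]
  rw [integral_finsetSum _ hint]
  refine Finset.sum_congr rfl fun t ht => ?_
  have hd := hdpos t ht
  rw [psiSharp_exp_sub_eq_integral hφ hψ hU₀ hX hX3 hc, ← integral_const_mul, ← integral_const_mul]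
  refine integral_congr_ae (ae_of_all _ fun τ => ?_)
  simp only
  rw [natCast_cpow_neg_zetaSlotS hd]
  push_cast
  ring

/-- **Stability of the model sum**: if `Ψ(e^{c - log d}) = 0` for `d > D` then for `D < N₀ ≤ N` the sums
over the subsets of the primes `< N` and `< N₀` agree. [folklore] -/
theorem sum_powerset_eq_of_support (φ ψ : ℝ → ℝ) (X U₀ c : ℝ) {D N₀ N : ℕ} (hD : D < N₀) (hN : N₀ ≤ N)
    (hΨ : ∀ d : ℕ, D < d → psiSharp φ ψ X U₀ (Real.exp (c - Real.log d)) = 0) :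
    ∑ t ∈ (Nat.primesBelow N).powerset,
        (-1 : ℂ) ^ #t * (((∏ p ∈ t, p : ℕ) : ℝ)⁻¹ : ℝ) *
          ((psiSharp φ ψ X U₀ (Real.exp (c - Real.log ((∏ p ∈ t, p : ℕ) : ℝ))) : ℝ) : ℂ) =
      ∑ t ∈ (Nat.primesBelow N₀).powerset,
        (-1 : ℂ) ^ #t * (((∏ p ∈ t, p : ℕ) : ℝ)⁻¹ : ℝ) *
          ((psiSharp φ ψ X U₀ (Real.exp (c - Real.log ((∏ p ∈ t, p : ℕ) : ℝ))) : ℝ) : ℂ) := by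
  symm
  refine Finset.sum_subset (Finset.powerset_mono.mpr fun p hp => ?_) fun t ht hnt => ?_
  · rw [Nat.mem_primesBelow] at hp ⊢
    exact ⟨lt_of_lt_of_le hp.1 hN, hp.2⟩
  · -- `t` contains a prime `≥ N₀ > D`, so `d_t > D`
    rw [Finset.mem_powerset] at ht hnt
    obtain ⟨p, hpt, hpN₀⟩ := Finset.not_subset.mp hnt
    have hp := ht hpt
    rw [Nat.mem_primesBelow] at hp
    have hpge : N₀ ≤ p := by
      by_contra h
      exact hpN₀ (Nat.mem_primesBelow.mpr ⟨not_le.mp h, hp.2⟩)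
    have hdvd : p ∣ ∏ q ∈ t, q := Finset.dvd_prod_of_mem _ hpt
    have hpos : 0 < ∏ q ∈ t, q := Finset.prod_pos fun q hq => (ht hq |> Nat.mem_primesBelow.mp).2.pos
    have hge : D < ∏ q ∈ t, q := lt_of_lt_of_le (lt_of_lt_of_le hD hpge) (Nat.le_of_dvd hpos hdvd)
    have := hΨ _ hge
    rw [this]
    simp

/-- **The model slot equals its `ζ`-limit**: `∫ ĝ_c ∏_{p<N}(1-p^{-s}) dτ → ∫ ĝ_c ζ(s)⁻¹ dτ` as `N → ∞`
(dominated convergence), hence, the left side being constant for `N > D`, they are equal.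
[cite: TaoTeravainen2021, §8 (8.25) with (2.7)] -/
theorem integral_psiFourier_eulerTrunc_eq_zeta {φ ψ : ℝ → ℝ} (hφ : IsBump φ) (hψ : IsSmoothCutoff ψ)
    {X U₀ : ℝ} (hU₀ : 1 ≤ U₀) (hX : 2 * U₀ + 2 ≤ X) (hX3 : 3 * U₀ ≤ X) {c : ℝ} (hc : c ≤ X + 1) {D N : ℕ}
    (hDN : D < N) (hΨ : ∀ d : ℕ, D < d → psiSharp φ ψ X U₀ (Real.exp (c - Real.log d)) = 0) :
    ∫ τ : ℝ, psiFourier φ ψ X U₀ c τ * eulerTrunc N (zetaSlotS X τ) =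
      ∫ τ : ℝ, psiFourier φ ψ X U₀ c τ * (riemannZeta (zetaSlotS X τ))⁻¹ := by
  have hX0 : 0 < X := by linarith
  have hre : ∀ τ, 1 < (zetaSlotS X τ).re := fun τ => by rw [re_zetaSlotS]; have := inv_pos.mpr hX0; linarith
  have hFint := (integrable_psiFourier hφ hψ hU₀ hX hc).1
  have hU₀0 : 0 < U₀ := by linarith
  have hcontF : Continuous (psiFourier φ ψ X U₀ c) :=
    VectorFourier.fourierIntegral_continuous Real.continuous_fourierChar (by exact continuous_inner)
      ((contDiff_psiTwist hφ hψ X hU₀0 c).continuous.integrable_of_hasCompactSupport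
        (hasCompactSupport_psiTwist hφ hψ X hU₀0 c))
  -- dominated convergence
  have hlim : Tendsto (fun M : ℕ => ∫ τ : ℝ, psiFourier φ ψ X U₀ c τ * eulerTrunc M (zetaSlotS X τ)) atTop
      (𝓝 (∫ τ : ℝ, psiFourier φ ψ X U₀ c τ * (riemannZeta (zetaSlotS X τ))⁻¹)) := by
    refine tendsto_integral_of_dominated_convergence (fun τ => Real.exp (1 + 1 / X⁻¹) * ‖psiFourier φ ψ X U₀ c τ‖)
      (fun M => ?_) (hFint.norm.const_mul _) (fun M => ae_of_all _ fun τ => ?_) (ae_of_all _ fun τ => ?_)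
    · have hcont : Continuous fun τ : ℝ => eulerTrunc M (zetaSlotS X τ) := by
        unfold eulerTrunc
        refine continuous_finsetProd _ fun p hp => continuous_const.sub ?_
        exact continuous_const.cpow (continuous_zetaSlotS X).neg fun τ => Or.inl (by
          exact_mod_cast (Nat.prime_of_mem_primesBelow hp).pos)
      exact (hcontF.mul hcont).aestronglyMeasurable
    · rw [norm_mul, mul_comm]
      refine mul_le_mul_of_nonneg_right ?_ (norm_nonneg _)
      have h := norm_eulerTrunc_le (hre τ) M
      rw [re_zetaSlotS, add_sub_cancel_left] at h
      exact h
    · exact (tendsto_eulerTrunc (hre τ)).const_mul _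
  -- the sequence is eventually constant
  have hconst : ∀ M, N ≤ M → ∫ τ : ℝ, psiFourier φ ψ X U₀ c τ * eulerTrunc M (zetaSlotS X τ) =
      ∫ τ : ℝ, psiFourier φ ψ X U₀ c τ * eulerTrunc N (zetaSlotS X τ) := by
    intro M hM
    rw [integral_psiFourier_eulerTrunc_eq_sum hφ hψ hU₀ hX hX3 hc, integral_psiFourier_eulerTrunc_eq_sum hφ hψ hU₀ hX hX3 hc]
    exact sum_powerset_eq_of_support φ ψ X U₀ c hDN hM hΨ
  have hlim' : Tendsto (fun M : ℕ => ∫ τ : ℝ, psiFourier φ ψ X U₀ c τ * eulerTrunc M (zetaSlotS X τ)) atTop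
      (𝓝 (∫ τ : ℝ, psiFourier φ ψ X U₀ c τ * eulerTrunc N (zetaSlotS X τ))) :=
    tendsto_const_nhds.congr' (Filter.eventually_atTop.mpr ⟨N, fun M hM => (hconst M hM).symm⟩)
  exact tendsto_nhds_unique hlim' hlim


/-! ### The Möbius slot is `1 + o(1)` -/

/-- `∫ (1 + (U₀τ)²)⁻¹ dτ = π/U₀` (`U₀ > 0`). [folklore] -/
theorem integral_inv_one_add_mul_sq {U₀ : ℝ} (hU₀ : 0 < U₀) : ∫ τ : ℝ, (1 + (U₀ * τ) ^ 2)⁻¹ = π / U₀ := by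
  have h := Measure.integral_comp_mul_left (fun y : ℝ => (1 + y ^ 2)⁻¹) U₀
  rw [h, integral_univ_inv_one_add_sq, abs_of_pos (inv_pos.mpr hU₀), smul_eq_mul]
  ring

/-- `τ ↦ (1 + (U₀τ)²)⁻¹` is integrable (`U₀ ≠ 0`). [folklore] -/
theorem integrable_inv_one_add_mul_sq {U₀ : ℝ} (hU₀ : U₀ ≠ 0) : Integrable fun τ : ℝ => (1 + (U₀ * τ) ^ 2)⁻¹ := by
  have h := integrable_inv_one_add_sq.comp_mul_left' hU₀
  simpa using h

set_option maxHeartbeats 800000 in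
/-- **The Möbius slot is `1 + o(1)`**: with `C₀` as in `exists_bound_riemannZeta₀`, `|ψ⁽ⁱ⁾| ≤ M_i`,
`U₀ ≥ 1`, `2U₀ + 2 ≤ X`, `3U₀ ≤ X`, `c ≤ X + 1`, `Ψ(e^{c - log d}) = 0` for `d > D`, `Ψ(e^w) = w` near
`w = c`, `D < N`, `0 < τ₀` with `1/X + 2πτ₀ ≤ 1/(2C₀)`, and `n ≥ 3`:
`‖∫ ĝ_c(τ) ∏_{p<N}(1 - p^{-s(τ)}) dτ - 1‖ ≤ 2τ₀ · S_g · 2C₀(1/X + 2πτ₀)² + 7(X+2) D_n (1+U₀τ₀)^{3-n} π/U₀`,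
`S_g = 6eU₀(X+2U₀)M₀`, `D_n = 2ⁿ6eU₀(1+n)(X+2U₀)∑_{i≤n}M_i`
("we conclude that `∏_p E_{p,t} = 𝔖 log^{-k}x ∏_j(1+t_{0,j}) + O(…)` … Using (8.15), (8.16) we obtain
(8.8)", one slot at a time). [cite: TaoTeravainen2021, §8 (8.25) with (2.7) and (8.16)] -/
theorem norm_integral_psiFourier_eulerTrunc_sub_one_le {φ ψ : ℝ → ℝ} (hφ : IsBump φ) (hψ : IsSmoothCutoff ψ)
    {M : ℕ → ℝ} (hM : ∀ i u, |iteratedDeriv i ψ u| ≤ M i) {X U₀ : ℝ} (hU₀ : 1 ≤ U₀) (hX : 2 * U₀ + 2 ≤ X)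
    (hX3 : 3 * U₀ ≤ X) {c : ℝ} (hc : c ≤ X + 1) {D N : ℕ} (hDN : D < N)
    (hΨ : ∀ d : ℕ, D < d → psiSharp φ ψ X U₀ (Real.exp (c - Real.log d)) = 0) {δ : ℝ} (hδ : 0 < δ)
    (hbulk : ∀ w ∈ Set.Ioo (c - δ) (c + δ), psiLog φ ψ X U₀ w = w) {C₀ : ℝ} (hC₀ : 1 ≤ C₀)
    (hζ₀ : ∀ σ : ℂ, ‖σ‖ ≤ 1 → ‖riemannZeta₀ (1 + σ)‖ ≤ C₀) {τ₀ : ℝ} (hτ₀ : 0 < τ₀)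
    (hsmall : X⁻¹ + 2 * π * τ₀ ≤ 1 / (2 * C₀)) {n : ℕ} (hn : 3 ≤ n) :
    ‖(∫ τ : ℝ, psiFourier φ ψ X U₀ c τ * eulerTrunc N (zetaSlotS X τ)) - 1‖ ≤
      2 * τ₀ * (6 * Real.exp 1 * U₀ * ((X + 2 * U₀) * cutoffDerivSum M 0)) * (2 * C₀ * (X⁻¹ + 2 * π * τ₀) ^ 2) +
        7 * (X + 2) * (2 ^ n * (6 * Real.exp 1) * U₀ * ((1 + n) * (X + 2 * U₀) * cutoffDerivSum M n)) *
          (1 + U₀ * τ₀) ^ 3 / (1 + U₀ * τ₀) ^ n * (π / U₀) := by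
  have hX0 : 0 < X := by linarith
  have hU₀0 : 0 < U₀ := by linarith
  have hC₀0 : 0 < C₀ := by linarith
  have hM0 : ∀ i, 0 ≤ M i := fun i => (abs_nonneg _).trans (hM i 0)
  set F := psiFourier φ ψ X U₀ c with hFdef
  set Sg : ℝ := 6 * Real.exp 1 * U₀ * ((X + 2 * U₀) * cutoffDerivSum M 0) with hSg
  set Dn : ℝ := 2 ^ n * (6 * Real.exp 1) * U₀ * ((1 + n) * (X + 2 * U₀) * cutoffDerivSum M n) with hDn
  have hSg0 : 0 ≤ Sg := by
    have : 0 ≤ cutoffDerivSum M 0 := Finset.sum_nonneg fun i _ => hM0 i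
    have : 0 ≤ X + 2 * U₀ := by linarith
    positivity
  have hDn0 : 0 ≤ Dn := by
    have : 0 ≤ cutoffDerivSum M n := Finset.sum_nonneg fun i _ => hM0 i
    have : 0 ≤ X + 2 * U₀ := by linarith
    positivity
  -- the pointwise bounds for `ĝ`
  have hg0 : ∀ τ, ‖F τ‖ ≤ Sg := by
    intro τ
    have h := psiFourier_decay hφ hψ hM hU₀ hX hc 0 τ
    simp only [pow_zero, one_mul, Nat.cast_zero, add_zero] at h
    rw [hSg]; linarith
  have hgn : ∀ τ, (1 + U₀ * |τ|) ^ n * ‖F τ‖ ≤ Dn := fun τ => psiFourier_decay hφ hψ hM hU₀ hX hc n τ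
  -- rewrite `∫ F E_N = ∫ F ζ⁻¹`, and `1 = ∫ F σ`
  rw [hFdef, integral_psiFourier_eulerTrunc_eq_zeta hφ hψ hU₀ hX hX3 hc hDN hΨ, ← hFdef]
  have hone := integral_psiFourier_mul_eq_one hφ hψ hU₀ hX hc hδ hbulk
  rw [← hFdef] at hone
  set σf : ℝ → ℂ := fun τ => ((X⁻¹ : ℝ) : ℂ) - 2 * π * I * τ with hσf
  have hσs : ∀ τ, zetaSlotS X τ = 1 + σf τ := fun τ => by simp only [hσf, zetaSlotS]; push_cast; ring
  have hre : ∀ τ, 1 < (zetaSlotS X τ).re := fun τ => by rw [re_zetaSlotS]; have := inv_pos.mpr hX0; linarith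
  obtain ⟨hFint, hFint1⟩ := integrable_psiFourier hφ hψ hU₀ hX hc
  rw [← hFdef] at hFint hFint1
  have hintσ : Integrable fun τ => F τ * σf τ := by
    have h1 : Integrable fun τ : ℝ => ((X⁻¹ : ℝ) : ℂ) * F τ - (2 * π * I) * ((τ : ℂ) * F τ) :=
      (hFint.const_mul _).sub (hFint1.const_mul _)
    refine h1.congr (ae_of_all _ fun τ => ?_)
    simp only [hσf]; ring
  have hintζ : Integrable fun τ => F τ * (riemannZeta (zetaSlotS X τ))⁻¹ := by
    have hcont : Continuous fun τ : ℝ => (riemannZeta (zetaSlotS X τ))⁻¹ := by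
      refine Continuous.inv₀ ?_ fun τ => riemannZeta_ne_zero_of_one_lt_re (hre τ)
      refine continuous_iff_continuousAt.mpr fun τ => ?_
      exact (differentiableAt_riemannZeta (by
        intro h; have := congr_arg Complex.re h; rw [re_zetaSlotS] at this; simp at this
        have := inv_pos.mpr hX0; linarith)).continuousAt.comp (continuous_zetaSlotS X).continuousAt
    refine hFint.mul_bdd (c := 1 + X) hcont.aestronglyMeasurable (ae_of_all _ fun τ => ?_)
    have h := norm_inv_riemannZeta_le (hre τ)
    rw [re_zetaSlotS, add_sub_cancel_left, one_div, inv_inv] at h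
    exact h
  have hdiff : (∫ τ : ℝ, F τ * (riemannZeta (zetaSlotS X τ))⁻¹) - 1 =
      ∫ τ : ℝ, F τ * ((riemannZeta (1 + σf τ))⁻¹ - σf τ) := by
    calc (∫ τ : ℝ, F τ * (riemannZeta (zetaSlotS X τ))⁻¹) - 1
        = (∫ τ : ℝ, F τ * (riemannZeta (zetaSlotS X τ))⁻¹) - ∫ τ : ℝ, F τ * σf τ := by rw [hone]
      _ = ∫ τ : ℝ, (F τ * (riemannZeta (zetaSlotS X τ))⁻¹ - F τ * σf τ) := (integral_sub hintζ hintσ).symm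
      _ = _ := by
          refine integral_congr_ae (ae_of_all _ fun τ => ?_)
          beta_reduce
          rw [hσs]; ring
  rw [hdiff]
  -- the majorant
  set A : ℝ := Sg * (2 * C₀ * (X⁻¹ + 2 * π * τ₀) ^ 2) with hA
  set Bc : ℝ := 7 * (X + 2) * Dn * ((1 + U₀ * τ₀) ^ 3 / (1 + U₀ * τ₀) ^ n) with hBc
  have hA0 : 0 ≤ A := by positivity
  have hBc0 : 0 ≤ Bc := by
    have : 0 ≤ X + 2 := by linarith
    rw [hBc]; positivity
  set m : ℝ → ℝ := fun τ => A * (Set.Icc (-τ₀) τ₀).indicator (fun _ => (1 : ℝ)) τ + Bc * (1 + (U₀ * τ) ^ 2)⁻¹ with hm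
  have hind_int : Integrable fun τ : ℝ => (Set.Icc (-τ₀) τ₀).indicator (fun _ => (1 : ℝ)) τ :=
    (continuous_const.integrableOn_Icc (a := -τ₀) (b := τ₀)).integrable_indicator measurableSet_Icc
  have hm_int : Integrable m :=
    (hind_int.const_mul A).add ((integrable_inv_one_add_mul_sq hU₀0.ne').const_mul Bc)
  have hm_val : ∫ τ, m τ = A * (2 * τ₀) + Bc * (π / U₀) := by
    simp only [hm]
    rw [integral_add (hind_int.const_mul A) ((integrable_inv_one_add_mul_sq hU₀0.ne').const_mul Bc),
      integral_const_mul, integral_const_mul, integral_indicator measurableSet_Icc,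
      integral_inv_one_add_mul_sq hU₀0, setIntegral_const, smul_eq_mul, mul_one, Real.volume_real_Icc_of_le (by linarith)]
    ring
  -- pointwise domination
  have hpt : ∀ τ, ‖F τ * ((riemannZeta (1 + σf τ))⁻¹ - σf τ)‖ ≤ m τ := by
    intro τ
    rw [norm_mul]
    have hn2 : ‖(2 : ℂ) * π * I * τ‖ = 2 * π * |τ| := by
      rw [norm_mul, norm_mul, norm_mul, Complex.norm_I, mul_one, Complex.norm_real, Complex.norm_real,
        Real.norm_eq_abs, Real.norm_eq_abs, abs_of_pos Real.pi_pos, Complex.norm_two]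
    have hσnorm : ‖σf τ‖ ≤ X⁻¹ + 2 * π * |τ| := by
      simp only [hσf]
      refine (norm_sub_le _ _).trans ?_
      rw [Complex.norm_real, Real.norm_eq_abs, abs_of_pos (inv_pos.mpr hX0), hn2]
    have hσre : (σf τ).re = X⁻¹ := by
      simp only [hσf, Complex.sub_re, Complex.ofReal_re, Complex.mul_re, Complex.re_ofNat, Complex.ofReal_im,
        Complex.im_ofNat, Complex.I_re, Complex.I_im, Complex.mul_im]
      ring
    have hσne : σf τ ≠ 0 := by
      intro h; have := congr_arg Complex.re h; rw [hσre] at this; simp at this; exact hX0.ne' this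
    by_cases hτ : |τ| ≤ τ₀
    · -- near zero: `‖ζ⁻¹ - σ‖ ≤ 2C₀‖σ‖²`
      have hle : X⁻¹ + 2 * π * |τ| ≤ X⁻¹ + 2 * π * τ₀ := by gcongr
      have hσsmall : ‖σf τ‖ ≤ 1 / (2 * C₀) := hσnorm.trans (hle.trans hsmall)
      have hz := norm_inv_riemannZeta_sub_le hC₀ hζ₀ hσne hσsmall
      have hind : (Set.Icc (-τ₀) τ₀).indicator (fun _ => (1 : ℝ)) τ = 1 := by
        rw [Set.indicator_of_mem]; rw [Set.mem_Icc]; rw [abs_le] at hτ; exact hτ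
      simp only [hm, hind, mul_one]
      have h2 : ‖(riemannZeta (1 + σf τ))⁻¹ - σf τ‖ ≤ 2 * C₀ * (X⁻¹ + 2 * π * τ₀) ^ 2 := by
        refine hz.trans ?_
        have := hσnorm.trans hle
        gcongr
      calc ‖F τ‖ * ‖(riemannZeta (1 + σf τ))⁻¹ - σf τ‖ ≤ Sg * (2 * C₀ * (X⁻¹ + 2 * π * τ₀) ^ 2) :=
            mul_le_mul (hg0 τ) h2 (norm_nonneg _) hSg0
        _ = A := by rw [hA]
        _ ≤ A + Bc * (1 + (U₀ * τ) ^ 2)⁻¹ := le_add_of_nonneg_right (by positivity)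
    · -- away from zero: crude bounds and the decay of `ĝ`
      push Not at hτ
      have hind0 : 0 ≤ A * (Set.Icc (-τ₀) τ₀).indicator (fun _ => (1 : ℝ)) τ := by
        refine mul_nonneg hA0 (Set.indicator_nonneg (fun _ _ => zero_le_one) _)
      have hz1 : ‖(riemannZeta (1 + σf τ))⁻¹‖ ≤ 1 + X := by
        have h := norm_inv_riemannZeta_le (s := 1 + σf τ) (by rw [Complex.add_re, Complex.one_re, hσre]; have := inv_pos.mpr hX0; linarith)
        rw [Complex.add_re, Complex.one_re, hσre, add_sub_cancel_left, one_div, inv_inv] at h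
        exact h
      have hz2 : ‖(riemannZeta (1 + σf τ))⁻¹ - σf τ‖ ≤ (X + 2) * (1 + 2 * π * |τ|) := by
        refine (norm_sub_le _ _).trans ?_
        have hXinv : X⁻¹ ≤ 1 := inv_le_one_of_one_le₀ (by linarith)
        have ha : 0 ≤ 2 * π * |τ| := by positivity
        have hb : 2 * π * |τ| ≤ (X + 2) * (2 * π * |τ|) := le_mul_of_one_le_left ha (by linarith)
        have hexp : (X + 2) * (1 + 2 * π * |τ|) = (X + 2) + (X + 2) * (2 * π * |τ|) := by ring
        linarith [hz1, hσnorm]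
      -- `‖F τ‖ ≤ Dn/(1+U₀|τ|)^n`
      set w := 1 + U₀ * |τ| with hw
      have hw1 : 1 ≤ w := by rw [hw]; have := abs_nonneg τ; nlinarith
      have hw0 : 0 < w := by linarith
      have hwτ₀ : 1 + U₀ * τ₀ ≤ w := by rw [hw]; gcongr
      have hFle : ‖F τ‖ ≤ Dn / w ^ n := by rw [le_div_iff₀ (by positivity), mul_comm]; exact hgn τ
      have h12 : 1 + 2 * π * |τ| ≤ 7 * w := by
        rw [hw]
        have : 2 * π * |τ| ≤ 7 * (U₀ * |τ|) := by
          have := Real.pi_lt_d2; have := abs_nonneg τ; nlinarith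
        linarith
      -- assemble: `‖F‖ (X+2)(1+2π|τ|) ≤ 7(X+2) Dn / w^{n-1} ≤ Bc (1+(U₀τ)²)⁻¹`
      have hn1 : w ^ n = w ^ (n - 3) * w ^ 2 * w := by
        have h3 : n = (n - 3) + 2 + 1 := by omega
        conv_lhs => rw [h3]
        rw [pow_add, pow_add, pow_one]
      have hmain : ‖F τ‖ * ((X + 2) * (1 + 2 * π * |τ|)) ≤ Bc * (1 + (U₀ * τ) ^ 2)⁻¹ := by
        have hX2 : 0 ≤ X + 2 := by linarith
        calc ‖F τ‖ * ((X + 2) * (1 + 2 * π * |τ|)) ≤ (Dn / w ^ n) * ((X + 2) * (7 * w)) := by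
              refine mul_le_mul hFle (by gcongr) (by positivity) (by positivity)
          _ = 7 * (X + 2) * Dn * (w / w ^ n) := by ring
          _ = 7 * (X + 2) * Dn * (1 / (w ^ (n - 3) * w ^ 2)) := by
              rw [hn1]; field_simp
          _ ≤ 7 * (X + 2) * Dn * (1 / ((1 + U₀ * τ₀) ^ (n - 3) * (1 + (U₀ * τ) ^ 2))) := by
              refine mul_le_mul_of_nonneg_left ?_ (by positivity)
              refine one_div_le_one_div_of_le (by positivity) ?_
              refine mul_le_mul (pow_le_pow_left₀ (by positivity) hwτ₀ _) ?_ (by positivity) (by positivity)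
              rw [hw]
              have h0 : 0 ≤ U₀ * |τ| := by positivity
              have hsq : (U₀ * τ) ^ 2 = (U₀ * |τ|) ^ 2 := by rw [mul_pow, mul_pow, sq_abs]
              rw [hsq]
              nlinarith [h0]
          _ = Bc * (1 + (U₀ * τ) ^ 2)⁻¹ := by
              rw [hBc]
              have h3 : (1 + U₀ * τ₀) ^ 3 / (1 + U₀ * τ₀) ^ n = 1 / (1 + U₀ * τ₀) ^ (n - 3) := by
                rw [div_eq_div_iff (by positivity) (by positivity), one_mul, ← pow_add]
                congr 1; omega
              rw [h3]
              field_simp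
      calc ‖F τ‖ * ‖(riemannZeta (1 + σf τ))⁻¹ - σf τ‖ ≤ ‖F τ‖ * ((X + 2) * (1 + 2 * π * |τ|)) :=
            mul_le_mul_of_nonneg_left hz2 (norm_nonneg _)
        _ ≤ Bc * (1 + (U₀ * τ) ^ 2)⁻¹ := hmain
        _ ≤ m τ := by simp only [hm]; linarith
  calc ‖∫ τ : ℝ, F τ * ((riemannZeta (1 + σf τ))⁻¹ - σf τ)‖ ≤ ∫ τ, m τ :=
        norm_integral_le_of_norm_le hm_int (ae_of_all _ hpt)
    _ = A * (2 * τ₀) + Bc * (π / U₀) := hm_val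
    _ = _ := by rw [hA, hBc]; ring


end TaoTeravainen

end Literature.Barriers.Parity
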